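import Mathlib
import Literature.RingTheory.HopfAlgebra.FiniteDualGroupLikePoints
import HarnessLib

/-!
# `G(S) ≃ GroupLike_S(S ⊗_R B^*)` is an isomorphism of MONOIDS (of groups for a commutative Hopf algebra)
(Tate, *Finite flat group schemes* (in Cornell–Silverman–Stevens 1997), §(3.8) «The dual Hopf algebra and Cartier duality»,
p. 145: «`G(B)` is the GROUP of group-like elements in `A′_B`»; Montgomery, *Hopf algebras and their actions on rings*, CBMS 82
(1993), 9.1.4, Ex. 4.1.7 (the convolution product on `Hom(C, A)`))

Topic `RingTheory/HopfAlgebra`; namespace `Literature.RingTheory.HopfAlgebra.FiniteDual`.  THEOREMS ONLY (no definition, no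
instance, no notation, no named fact, no `sorry`); imports ★ `FiniteDualGroupLikePoints` (F5: the BIJECTION `G(S) = Hom_{R-alg}(B, S)
≃ GroupLike_S (S ⊗_R B^*)` pinned by the pairing `Ψ (s ⊗ f) b = f b • s`) + Mathlib.  Cell `pub/hodgecm-mathlib` (D-0151), FLOOR 0,
programme F0P5a (crux item stmt-HodgeConjecture-24832; PLAN v4.1 §2 row H-CD «Cartier duality at `p`», KF8; piece **CD1-pts-M**) —
road- and floor-independent commutative algebra; changes no count.

SETTING (as F5).  `R` a commutative ring, `B` a finite free `R`-bialgebra, `S` a commutative `R`-algebra,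
`W := WithConv (Module.Dual R B)` with ★ F3's dual bialgebra `FiniteDual.bialgebra R B` (installed by `letI` INSIDE each statement),
so `S ⊗[R] W` is an `S`-coalgebra and an `R`-algebra; on the other side Mathlib's convolution monoid `WithConv (B →ₐ[R] S)` of `S`-points (`Mathlib.RingTheory.Bialgebra.Convolution`; a GROUP
`AlgHom.convGroup` when `B` is a commutative Hopf algebra).  Products on `S ⊗[R] W` are written through the bilinear
`LinearMap.mul R (S ⊗[R] W)` (the form Mathlib's `Bialgebra.mul_compr₂_comul` uses; see ★ `FiniteDualBialgebraLaws`).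

RESULTS:
* §1 **`pointPairing_map_mul`** `: Ψ (LinearMap.mul R (S ⊗[R] W) x y) = (toConv (Ψ x) * toConv (Ψ y)).ofConv` — the pairing
  `S ⊗_R B^* → Hom_R(B, S)` is MULTIPLICATIVE from the tensor-product algebra to the convolution algebra (product formula
  `(f g)(b) = Σ f(b₁) g(b₂)`), and **`pointPairing_one`** `: Ψ 1 = 1`.
* §2 **`isGroupLikeElem_baseChange_mul`**, **`isGroupLikeElem_baseChange_one`** (group-likes of `S ⊗_R B^*` are closed under the
  product and contain `1`) and **`exists_equiv_groupLike_points`** — the bijection `{x // IsGroupLikeElem S x} ≃ WithConv (B →ₐ[R] S)`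
  pinned by `Ψ` is UNITAL and MULTIPLICATIVE: «`G(S) = GroupLike_S (S ⊗_R B^*)` AS MONOIDS» (groups for a commutative Hopf `B`).
  It is stated on the subtype rather than on Mathlib's `GroupLike S (S ⊗[R] W)` because that type's `Monoid` instance does not
  elaborate on this carrier (the `Module R W` instance paths `WithConv.instModule` ∕ `Algebra.toModule LinearMap.convAlgebra` are not
  reducibly equal — a known `WithConv` wart; everything here goes through `Ψ` instead).
NOT here: naturality in `S`, schemes.

HC_CM is proved only modulo the 7 printed citations until rung 0 closes; this file is generic algebra and changes no count.

## References
* [Tate1997FiniteFlatGroupSchemes] J. Tate, *Finite flat group schemes*, in: Modular Forms and Fermat's Last Theorem (1997), §(3.8)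
  p. 145.
* [Montgomery1993Hopf] S. Montgomery, *Hopf algebras and their actions on rings*, CBMS 82 (1993), 9.1.4.
-/

set_option autoImplicit false

noncomputable section

open TensorProduct Module WithConv Coalgebra

namespace Literature.RingTheory.HopfAlgebra

namespace FiniteDual

universe u v w

/-! ## §1 The pairing `S ⊗_R B^* → Hom_R(B, S)` is a map of monoids (tensor algebra → convolution) -/

section MapMul

variable {R : Type u} [CommRing R] {B : Type v} [Semiring B] [Bialgebra R B]
variable {S : Type w} [CommRing S] [Algebra R S]
variable {Ψ : S ⊗[R] WithConv (Module.Dual R B) →ₗ[R] (B →ₗ[R] S)}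

/-- the product formula on pure tensors: `Ψ ((s ⊗ f)(s' ⊗ g)) = Ψ (s ⊗ f) * Ψ (s' ⊗ g)` in the convolution algebra
`Hom_R(B, S)` (`(s s') (f g)(b) = Σ (f(b₁) s)(g(b₂) s')`). [cite: Montgomery1993Hopf, 9.1.4] -/
theorem pointPairing_tmul_mul_tmul
    (hΨ : ∀ (s : S) (f : WithConv (Module.Dual R B)) (b : B), Ψ (s ⊗ₜ f) b = f b • s)
    (s s' : S) (f g : WithConv (Module.Dual R B)) :
    Ψ ((s * s') ⊗ₜ (f * g)) = (toConv (Ψ (s ⊗ₜ f)) * toConv (Ψ (s' ⊗ₜ g))).ofConv := by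
  refine LinearMap.ext fun b => ?_
  rw [hΨ, (ℛ R b).convMul_apply, (ℛ R b).convMul_apply, Finset.sum_smul]
  refine Finset.sum_congr rfl fun i _ => ?_
  rw [hΨ, hΨ, smul_mul_smul_comm]

/-- **the pairing `S ⊗_R B^* → Hom_R(B, S)` is MULTIPLICATIVE**: `Ψ (x y) = Ψ x * Ψ y`, the product on `S ⊗_R B^*` written
through Mathlib's bilinear `LinearMap.mul R (S ⊗[R] W)`, the product on `Hom_R(B, S)` being convolution.
[cite: Tate1997FiniteFlatGroupSchemes, §(3.8) p. 145; Montgomery1993Hopf, 9.1.4] -/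
theorem pointPairing_map_mul
    (hΨ : ∀ (s : S) (f : WithConv (Module.Dual R B)) (b : B), Ψ (s ⊗ₜ f) b = f b • s)
    (x y : S ⊗[R] WithConv (Module.Dual R B)) :
    Ψ (LinearMap.mul R (S ⊗[R] WithConv (Module.Dual R B)) x y) = (toConv (Ψ x) * toConv (Ψ y)).ofConv := by
  induction x using TensorProduct.induction_on with
  | zero => rw [map_zero, LinearMap.zero_apply, map_zero, toConv_zero, zero_mul, ofConv_zero]
  | tmul s f =>
    induction y using TensorProduct.induction_on with
    | zero => rw [map_zero, map_zero, toConv_zero, mul_zero, ofConv_zero]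
    | tmul s' g => rw [LinearMap.mul_apply', Algebra.TensorProduct.tmul_mul_tmul, pointPairing_tmul_mul_tmul hΨ]
    | add y y' hy hy' => rw [map_add, map_add, hy, hy', map_add, toConv_add, mul_add, ofConv_add]
  | add x x' hx hx' =>
    rw [map_add, LinearMap.add_apply, map_add, hx, hx', map_add, toConv_add, add_mul, ofConv_add]

/-- **the pairing is UNITAL**: `Ψ 1 = 1` (`1 ⊗ ε_B ↦ (b ↦ ε_B(b) · 1_S)`, the unit of the convolution algebra `Hom_R(B, S)`).
[cite: Montgomery1993Hopf, 9.1.4] -/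
theorem pointPairing_one
    (hΨ : ∀ (s : S) (f : WithConv (Module.Dual R B)) (b : B), Ψ (s ⊗ₜ f) b = f b • s) :
    Ψ 1 = (1 : WithConv (B →ₗ[R] S)).ofConv := by
  refine LinearMap.ext fun b => ?_
  rw [Algebra.TensorProduct.one_def, hΨ, LinearMap.convOne_apply, LinearMap.convOne_apply, Algebra.algebraMap_self,
    RingHom.id_apply, Algebra.algebraMap_eq_smul_one]

end MapMul

/-! ## §2 The group-like elements of `S ⊗_R B^*` form a monoid and `Ψ` identifies it with the convolution monoid of points -/

section Monoid

variable {R : Type u} [CommRing R] {B : Type v} [Semiring B] [Bialgebra R B] [Module.Free R B] [Module.Finite R B]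
variable {S : Type w} [CommRing S] [Algebra R S]
variable {Ψ : S ⊗[R] WithConv (Module.Dual R B) →ₗ[R] (B →ₗ[R] S)}

omit [Module.Free R B] [Module.Finite R B] in
/-- the convolution product of `S`-points has the convolution product of their linear maps as underlying linear map (Mathlib
`AlgHom.toLinearMap_convMul`, `rfl`). [cite: Montgomery1993Hopf, 9.1.4] -/
theorem toLinearMap_convMul_points (φ ψ : WithConv (B →ₐ[R] S)) :
    (φ * ψ).ofConv.toLinearMap = (toConv φ.ofConv.toLinearMap * toConv ψ.ofConv.toLinearMap).ofConv :=
  rfl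

/-- **group-like elements of `S ⊗_R B^*` are closed under the product** (written through `LinearMap.mul R (S ⊗[R] W)`): the
product of two `S`-points is an `S`-point (Mathlib's convolution monoid of algebra maps) and `Ψ` is multiplicative.
[cite: Tate1997FiniteFlatGroupSchemes, §(3.8) p. 145] -/
theorem isGroupLikeElem_baseChange_mul
    (hΨ : ∀ (s : S) (f : WithConv (Module.Dual R B)) (b : B), Ψ (s ⊗ₜ f) b = f b • s)
    {x y : S ⊗[R] WithConv (Module.Dual R B)}
    (hx : letI : Bialgebra R (WithConv (Module.Dual R B)) := FiniteDual.bialgebra R B; IsGroupLikeElem S x)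
    (hy : letI : Bialgebra R (WithConv (Module.Dual R B)) := FiniteDual.bialgebra R B; IsGroupLikeElem S y) :
    letI : Bialgebra R (WithConv (Module.Dual R B)) := FiniteDual.bialgebra R B
    IsGroupLikeElem S (LinearMap.mul R (S ⊗[R] WithConv (Module.Dual R B)) x y) := by
  obtain ⟨φ, hφ, -⟩ := existsUnique_algHom_of_isGroupLikeElem_baseChange hΨ hx
  obtain ⟨ψ, hψ, -⟩ := existsUnique_algHom_of_isGroupLikeElem_baseChange hΨ hy
  refine isGroupLikeElem_baseChange_of_eq_algHom hΨ (toConv φ * toConv ψ).ofConv ?_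
  rw [toLinearMap_convMul_points, ofConv_toConv, ofConv_toConv, hφ, hψ, pointPairing_map_mul hΨ]

/-- **the unit `1 ⊗ ε_B` of `S ⊗_R B^*` is group-like** (`Ψ 1 = 1` is the unit point `b ↦ ε_B(b) · 1`).
[cite: Tate1997FiniteFlatGroupSchemes, §(3.8) p. 145] -/
theorem isGroupLikeElem_baseChange_one
    (hΨ : ∀ (s : S) (f : WithConv (Module.Dual R B)) (b : B), Ψ (s ⊗ₜ f) b = f b • s) :
    letI : Bialgebra R (WithConv (Module.Dual R B)) := FiniteDual.bialgebra R B
    IsGroupLikeElem S (1 : S ⊗[R] WithConv (Module.Dual R B)) := by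
  refine isGroupLikeElem_baseChange_of_eq_algHom hΨ (1 : WithConv (B →ₐ[R] S)).ofConv ?_
  rw [pointPairing_one hΨ]
  rfl

variable (R B S) in
/-- **`G(S) = GroupLike_S (S ⊗_R B^*)` AS MONOIDS**: the bijection `Γ` between the group-like elements of `S ⊗_R B^*` (for the
base change of ★ F3's dual coalgebra) and the convolution monoid `WithConv (B →ₐ[R] S)` of `S`-points — pinned by `Ψ` on underlying
linear maps — is UNITAL and MULTIPLICATIVE for the product of `S ⊗_R B^*` (written through `LinearMap.mul R (S ⊗[R] W)`); for a
commutative Hopf algebra `B` the right side is a group in Mathlib (`AlgHom.convGroup`), so the group-like elements form a group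
isomorphic to `G(S)`.  (Stated on the subtype `{x // IsGroupLikeElem S x}` rather than Mathlib's `GroupLike S (S ⊗[R] W)`, whose
monoid instance does not elaborate on this carrier: the two `Module R W` instance paths `WithConv.instModule` ∕ `Algebra.toModule
LinearMap.convAlgebra` are not reducibly equal.)  [cite: Tate1997FiniteFlatGroupSchemes, §(3.8) p. 145; Montgomery1993Hopf, 9.1.4] -/
theorem exists_equiv_groupLike_points
    (hΨ : ∀ (s : S) (f : WithConv (Module.Dual R B)) (b : B), Ψ (s ⊗ₜ f) b = f b • s) :
    letI : Bialgebra R (WithConv (Module.Dual R B)) := FiniteDual.bialgebra R B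
    ∃ Γ : {x : S ⊗[R] WithConv (Module.Dual R B) // IsGroupLikeElem S x} ≃ WithConv (B →ₐ[R] S),
      (∀ g, (Γ g).ofConv.toLinearMap = Ψ g.1) ∧
      Γ ⟨1, isGroupLikeElem_baseChange_one hΨ⟩ = 1 ∧
      ∀ g h, Γ ⟨LinearMap.mul R (S ⊗[R] WithConv (Module.Dual R B)) g.1 h.1, isGroupLikeElem_baseChange_mul hΨ g.2 h.2⟩ =
        Γ g * Γ h := by
  letI : Bialgebra R (WithConv (Module.Dual R B)) := FiniteDual.bialgebra R B
  -- the point of a group-like element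
  have hpt : ∀ g : {x : S ⊗[R] WithConv (Module.Dual R B) // IsGroupLikeElem S x},
      Ψ g.1 1 = 1 ∧ ∀ b b' : B, Ψ g.1 (b * b') = Ψ g.1 b * Ψ g.1 b' :=
    fun g => (isGroupLikeElem_baseChange_iff hΨ g.1).1 g.2
  let pt : {x : S ⊗[R] WithConv (Module.Dual R B) // IsGroupLikeElem S x} → WithConv (B →ₐ[R] S) := fun g =>
    toConv (AlgHom.ofLinearMap (Ψ g.1) (hpt g).1 (hpt g).2)
  have hptΨ : ∀ g, (pt g).ofConv.toLinearMap = Ψ g.1 := fun g => AlgHom.toLinearMap_ofLinearMap _ _ _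
  have hinj : Function.Injective pt := by
    intro g h hgh
    have h' : Ψ g.1 = Ψ h.1 := by rw [← hptΨ, ← hptΨ, hgh]
    exact Subtype.ext (eq_of_isGroupLikeElem_baseChange_of_pointPairing_eq hΨ g.2 h.2 h')
  have hsurj : Function.Surjective pt := by
    intro φ
    obtain ⟨x, ⟨hx, hxφ⟩, -⟩ := existsUnique_isGroupLikeElem_baseChange_of_algHom hΨ φ.ofConv
    refine ⟨⟨x, hx⟩, WithConv.ext (AlgHom.toLinearMap_injective ?_)⟩
    rw [hptΨ]
    exact hxφ
  refine ⟨Equiv.ofBijective pt ⟨hinj, hsurj⟩, hptΨ, ?_, fun g h => ?_⟩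
  · refine WithConv.ext (AlgHom.toLinearMap_injective ?_)
    rw [Equiv.ofBijective_apply, hptΨ, pointPairing_one hΨ]
    rfl
  · refine WithConv.ext (AlgHom.toLinearMap_injective ?_)
    rw [Equiv.ofBijective_apply, Equiv.ofBijective_apply, Equiv.ofBijective_apply, hptΨ, toLinearMap_convMul_points, hptΨ,
      hptΨ]
    exact pointPairing_map_mul hΨ g.1 h.1

end Monoid

end FiniteDual

end Literature.RingTheory.HopfAlgebra

end
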